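import Literature.Analysis.FluidPDE.OseenKernelBlocks
import Literature.Analysis.FluidPDE.KatoBilinearEstimates
import Literature.Analysis.FunctionSpaces.MinkowskiIntegral
import HarnessLib

/-!
# The Littlewood–Paley blocks of the Navier–Stokes Duhamel term: reduction to the blocked kernel

Analysis/FluidPDE proof file (no definitions, no named facts), continuing
`OseenKernelBlocks.lean` (the `L¹` bounds of the blocked Oseen–Koch–Tataru kernel
`Δ̇_j K(σ,·)[a,b] = blockFn j (oseenKernel σ · a b)` at low and high frequency). It reduces the
`L^p` norms of the blocks `Δ̇_j B(u,v)(t)` of the Duhamel term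
`B(u,v)(t) = ∫₀ᵗ e^{(t-s)Δ}ℙ∇·(u ⊗ v)(s) ds` (`kochTataruBilinear`, unit viscosity) of bounded,
jointly measurable fields to the `L¹` norms of the blocked kernel, everything **proved**:

* `§ Majorant`: bilinearity of `Δ̇_j K(σ,·)[a,b]` in `(a, b)` (the kernel is bilinear and the
  slices are integrable) and the **scalar majorant**
  `‖Δ̇_j K(σ,·)[a,b](z)‖ ≤ m_j(σ,z) ‖a‖‖b‖`, `m_j(σ,z) = ∑_{k,l} ‖Δ̇_j K(σ,·)[e_k,e_l](z)‖` over
  an orthonormal basis (`norm_blockFn_oseenKernel_le_sum_mul`, expansion of the bilinear map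
  `LinearMap.mk₂`);
* `§ Slice`: **the block of a slice is the convolution with the blocked kernel**,
  `Δ̇_j[e^{σΔ}ℙ∇·(a⊗b)](x) = ∫ Δ̇_j K(σ,·)[a(y),b(y)](x-y) dy` for bounded measurable `a`, `b`
  (`blockFn_oseenSlice_apply`: Fubini on `E × E`, the integrand being dominated by
  `‖a‖_∞‖b‖_∞|K_j(x-v)| C(σ+‖v-y‖²)^{-(d+1)/2}`, integrable by Tonelli), whence the domination
  `‖Δ̇_j[e^{σΔ}ℙ∇·(a⊗b)](x)‖ ≤ ∫ m_j(σ,y)‖a(x-y)‖‖b(x-y)‖dy` and **Young's inequality**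
  `‖Δ̇_j e^{σΔ}ℙ∇·(a⊗b)‖_{L^p} ≤ ‖m_j(σ)‖_{L¹} ‖|a||b|‖_{L^p}`, `1 ≤ p ≤ ∞`
  (`eLpNorm_blockFn_oseenSlice_le`, through `eLpNorm_le_lintegral_mul_eLpNorm_of_dominated`);
* `§ Duhamel`: **the block of the time integral is the time integral of the blocks**
  (`blockFn_setIntegral_apply`: Fubini on `E × (0,t)`, the integrand `K_j(z)S(s,x-z)` being
  integrable by Hölder `∫‖K_j(z)‖‖S(s,x-z)‖dz ≤ ‖K_j‖_{L^{p'}}‖S(s)‖_{L^p}` and an integrable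
  bound `‖S(s)‖_{L^p} ≤ Φ(s)`), **Minkowski's integral inequality**
  `‖Δ̇_j∫₀ᵗS(s)ds‖_{L^p} ≤ ∫₀ᵗ‖Δ̇_jS(s)‖_{L^p}ds` (`eLpNorm_blockFn_setIntegral_le`, `p < ∞`), and
  the assembled **block form of Kato's estimate**
  `‖Δ̇_j B(u,v)(t)‖_{L^p} ≤ ∫₀ᵗ ‖m_j(t-s)‖_{L¹} N(s) ds` whenever `‖|u(s)||v(s)|‖_{L^p} ≤ N(s)` with
  `(t-s)^{-1/2}N(s)` integrable (`eLpNorm_blockFn_kochTataruBilinear_le`; the diagonal bound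
  `‖e^{σΔ}ℙ∇·(a⊗b)‖_{L^p} ≤ Cσ^{-1/2}‖|a||b|‖_{L^p}` of `OseenKernelLp.lean` supplies `Φ`).

With the `L¹` bounds of `OseenKernelBlocks.lean` for `‖m_j(σ)‖_{L¹}` and the Kato weight
`N(s) = ‖u(s)‖_{L^p}‖u(s)‖_{L^∞} ≲ s^{-(1-3/(2p))}` this is the Besov regularity of the Duhamel term
of a Kato-class mild solution, `B(u,u)(t) ∈ Ḃ^{-1+3/p}_{p,q}` with an `ℓ¹ ∩ ℓ^∞` block profile
(Bahouri–Chemin–Danchin 2011, proof of Thm. 5.40; Gallagher–Koch–Planchon 2016, App. B), item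
"Duhamel term" of the local Cauchy theory
`Literature.Analysis.FluidPDE.exists_isBesovMildSolutionOn`.

## References

* H. Bahouri, J.-Y. Chemin, R. Danchin, *Fourier Analysis and Nonlinear PDE* (2011), Thm. 5.40
  and its proof, Lemma 2.4. [BahouriCheminDanchin2011]
* T. Kato, *Strong `L^p`-solutions of the Navier–Stokes equation in `ℝ^m`*, Math. Z. 187 (1984),
  (2.3)–(2.5). [Kato1984]
* I. Gallagher, G. S. Koch, F. Planchon, Comm. Math. Phys. 343 (2016) = arXiv:1407.4156, App. B.
  [GKP2016]
-/

noncomputable section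

open MeasureTheory Set Function Filter
open _root_.Topology
open scoped SchwartzMap ENNReal NNReal RealInnerProductSpace Convolution

namespace Literature.Analysis.FluidPDE

open FunctionSpaces (blockFn blockKernel)

section Majorant

variable {E : Type*} [NormedAddCommGroup E] [InnerProductSpace ℝ E] [FiniteDimensional ℝ E]
  [MeasurableSpace E] [BorelSpace E]

/-- The block in the reflected form `Δ̇_j v(x) = ∫ K_j(x - z) v(z) dz`. [folklore] -/
theorem blockFn_apply_sub {E' : Type*} [NormedAddCommGroup E'] [NormedSpace ℝ E'] (j : ℤ)
    (v : E → E') (x : E) : blockFn j v x = ∫ z, blockKernel E j (x - z) • v z := by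
  rw [FunctionSpaces.blockFn_apply]
  have h := integral_sub_left_eq_self (fun z => blockKernel E j (x - z) • v z) (volume : Measure E) x
  simp only [sub_sub_cancel] at h
  exact h

/-- The blocked kernel is additive in the first direction. [folklore] -/
theorem blockFn_oseenKernel_add_left (j : ℤ) {σ : ℝ} (hσ : 0 < σ) (a a' b : E) :
    blockFn j (fun z => oseenKernel σ z (a + a') b) =
      blockFn j (fun z => oseenKernel σ z a b) + blockFn j (fun z => oseenKernel σ z a' b) := by
  haveI : Fact ((1 : ℝ≥0∞) ≤ 1) := ⟨le_rfl⟩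
  have h : (fun z => oseenKernel σ z (a + a') b) =
      (fun z => oseenKernel σ z a b) + fun z => oseenKernel σ z a' b :=
    funext fun z => oseenKernel_add_left σ z a a' b
  rw [h]
  exact FunctionSpaces.blockFn_add j
    (memLp_one_iff_integrable.2 (integrable_oseenKernel_left_slice hσ a b))
    (memLp_one_iff_integrable.2 (integrable_oseenKernel_left_slice hσ a' b))

/-- The blocked kernel is additive in the second direction. [folklore] -/
theorem blockFn_oseenKernel_add_right (j : ℤ) {σ : ℝ} (hσ : 0 < σ) (a b b' : E) :
    blockFn j (fun z => oseenKernel σ z a (b + b')) =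
      blockFn j (fun z => oseenKernel σ z a b) + blockFn j (fun z => oseenKernel σ z a b') := by
  haveI : Fact ((1 : ℝ≥0∞) ≤ 1) := ⟨le_rfl⟩
  have h : (fun z => oseenKernel σ z a (b + b')) =
      (fun z => oseenKernel σ z a b) + fun z => oseenKernel σ z a b' :=
    funext fun z => oseenKernel_add_right σ z a b b'
  rw [h]
  exact FunctionSpaces.blockFn_add j
    (memLp_one_iff_integrable.2 (integrable_oseenKernel_left_slice hσ a b))
    (memLp_one_iff_integrable.2 (integrable_oseenKernel_left_slice hσ a b'))

/-- The blocked kernel is homogeneous in the first direction. [folklore] -/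
theorem blockFn_oseenKernel_smul_left (j : ℤ) (σ : ℝ) (c : ℝ) (a b : E) :
    blockFn j (fun z => oseenKernel σ z (c • a) b) = c • blockFn j (fun z => oseenKernel σ z a b) := by
  have h : (fun z => oseenKernel σ z (c • a) b) = c • fun z => oseenKernel σ z a b :=
    funext fun z => oseenKernel_smul_left σ z c a b
  rw [h, FunctionSpaces.blockFn_smul]

/-- The blocked kernel is homogeneous in the second direction. [folklore] -/
theorem blockFn_oseenKernel_smul_right (j : ℤ) (σ : ℝ) (c : ℝ) (a b : E) :
    blockFn j (fun z => oseenKernel σ z a (c • b)) = c • blockFn j (fun z => oseenKernel σ z a b) := by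
  have h : (fun z => oseenKernel σ z a (c • b)) = c • fun z => oseenKernel σ z a b :=
    funext fun z => oseenKernel_smul_right σ z c a b
  rw [h, FunctionSpaces.blockFn_smul]

/-- **The scalar majorant of the blocked kernel**: expanding `a`, `b` in an orthonormal basis
`(e_k)`, bilinearity gives `‖Δ̇_j K(σ,·)[a,b](z)‖ ≤ (∑_{k,l} ‖Δ̇_j K(σ,·)[e_k,e_l](z)‖) ‖a‖ ‖b‖`,
a bound by a scalar kernel independent of the directions — the form consumed by Young's inequality
for the slices `Δ̇_j e^{σΔ}ℙ∇·(a ⊗ b)`. [folklore] -/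
theorem norm_blockFn_oseenKernel_le_sum_mul (j : ℤ) {σ : ℝ} (hσ : 0 < σ) (a b z : E) :
    ‖blockFn j (fun w => oseenKernel σ w a b) z‖ ≤
      (∑ k, ∑ l, ‖blockFn j (fun w => oseenKernel σ w (stdOrthonormalBasis ℝ E k)
        (stdOrthonormalBasis ℝ E l)) z‖) * ‖a‖ * ‖b‖ := by
  set e := stdOrthonormalBasis ℝ E with he
  -- the bilinear map `(a, b) ↦ Δ̇_j K(σ,·)[a,b](z)`
  set B : E →ₗ[ℝ] E →ₗ[ℝ] E := LinearMap.mk₂ ℝ (fun a b => blockFn j (fun w => oseenKernel σ w a b) z)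
    (fun a a' b => by
      show blockFn j (fun w => oseenKernel σ w (a + a') b) z = _
      rw [blockFn_oseenKernel_add_left j hσ]; rfl)
    (fun c a b => by
      show blockFn j (fun w => oseenKernel σ w (c • a) b) z = _
      rw [blockFn_oseenKernel_smul_left]; rfl)
    (fun a b b' => by
      show blockFn j (fun w => oseenKernel σ w a (b + b')) z = _
      rw [blockFn_oseenKernel_add_right j hσ]; rfl)
    (fun c a b => by
      show blockFn j (fun w => oseenKernel σ w a (c • b)) z = _
      rw [blockFn_oseenKernel_smul_right]; rfl) with hB
  have hBapply : ∀ a b, B a b = blockFn j (fun w => oseenKernel σ w a b) z := fun a b => rfl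
  -- expansion in the basis
  have hexp : B a b = ∑ k, ∑ l, (e.repr a k * e.repr b l) • B (e k) (e l) := by
    conv_lhs => rw [← e.sum_repr a, ← e.sum_repr b]
    rw [LinearMap.map_sum₂]
    refine Finset.sum_congr rfl fun k _ => ?_
    rw [LinearMap.map_smul₂, map_sum, Finset.smul_sum]
    refine Finset.sum_congr rfl fun l _ => ?_
    rw [map_smul, smul_smul]
  rw [← hBapply, hexp]
  calc ‖∑ k, ∑ l, (e.repr a k * e.repr b l) • B (e k) (e l)‖
      ≤ ∑ k, ‖∑ l, (e.repr a k * e.repr b l) • B (e k) (e l)‖ := norm_sum_le _ _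
    _ ≤ ∑ k, ∑ l, ‖(e.repr a k * e.repr b l) • B (e k) (e l)‖ :=
        Finset.sum_le_sum fun k _ => norm_sum_le _ _
    _ ≤ ∑ k, ∑ l, ‖B (e k) (e l)‖ * ‖a‖ * ‖b‖ := by
        refine Finset.sum_le_sum fun k _ => Finset.sum_le_sum fun l _ => ?_
        rw [norm_smul, norm_mul, e.repr_apply_apply, e.repr_apply_apply]
        have ha : ‖⟪e k, a⟫‖ ≤ ‖a‖ := by
          refine (norm_inner_le_norm (e k) a).trans ?_
          rw [e.orthonormal.1 k, one_mul]
        have hb : ‖⟪e l, b⟫‖ ≤ ‖b‖ := by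
          refine (norm_inner_le_norm (e l) b).trans ?_
          rw [e.orthonormal.1 l, one_mul]
        calc ‖⟪e k, a⟫‖ * ‖⟪e l, b⟫‖ * ‖B (e k) (e l)‖ ≤ ‖a‖ * ‖b‖ * ‖B (e k) (e l)‖ := by
              gcongr
          _ = ‖B (e k) (e l)‖ * ‖a‖ * ‖b‖ := by ring
    _ = (∑ k, ∑ l, ‖B (e k) (e l)‖) * ‖a‖ * ‖b‖ := by
        rw [Finset.sum_mul, Finset.sum_mul]
        refine Finset.sum_congr rfl fun k _ => ?_
        rw [Finset.sum_mul, Finset.sum_mul]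

/-- The majorant is continuous (blocks of `L¹` fields are continuous? — we only need
measurability: each block is a.e.-strongly measurable, and a finite sum of norms of measurable
functions is measurable). [folklore] -/
theorem aestronglyMeasurable_blockFn_oseenKernel (j : ℤ) (σ : ℝ) (a b : E) :
    AEStronglyMeasurable (blockFn j (fun w => oseenKernel σ w a b)) volume :=
  FunctionSpaces.aestronglyMeasurable_blockFn j (measurable_oseenKernel_left σ a b).aestronglyMeasurable

end Majorant

end Literature.Analysis.FluidPDE


namespace Literature.Analysis.FluidPDE

open FunctionSpaces (blockFn blockKernel)

/-! ## The blocks of a slice `Δ̇_j e^{σΔ}ℙ∇·(a ⊗ b)`: Fubini and Young -/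

section Slice

variable {E : Type*} [NormedAddCommGroup E] [InnerProductSpace ℝ E] [FiniteDimensional ℝ E]
  [MeasurableSpace E] [BorelSpace E]

/-- Integrability on `E × E` of a product kernel `|K_j(x - v)| g(v - y)` with `g ∈ L¹`
(Tonelli: integrate in `y` first). [folklore] -/
theorem integrable_blockKernel_mul_comp_sub (j : ℤ) (x : E) {g : E → ℝ} (hg : Integrable g)
    (hgc : Continuous g) (hg0 : ∀ z, 0 ≤ g z) :
    Integrable (fun q : E × E => ‖blockKernel E j (x - q.1)‖ * g (q.1 - q.2))
      ((volume : Measure E).prod volume) := by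
  have hm : AEStronglyMeasurable (fun q : E × E => ‖blockKernel E j (x - q.1)‖ * g (q.1 - q.2))
      ((volume : Measure E).prod volume) :=
    ((((FunctionSpaces.continuous_blockKernel j).comp (continuous_const.sub continuous_fst)).norm).mul
      (hgc.comp (continuous_fst.sub continuous_snd))).aestronglyMeasurable
  refine ⟨hm, ?_⟩
  have hnn : ∀ q : E × E, 0 ≤ ‖blockKernel E j (x - q.1)‖ * g (q.1 - q.2) := fun q =>
    mul_nonneg (norm_nonneg _) (hg0 _)
  rw [HasFiniteIntegral, lintegral_prod _ hm.aemeasurable.enorm]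
  have hinner : ∀ v : E, ∫⁻ y, ‖‖blockKernel E j (x - v)‖ * g (v - y)‖ₑ =
      ‖blockKernel E j (x - v)‖ₑ * ∫⁻ z, ‖g z‖ₑ := by
    intro v
    have h1 : ∀ y, ‖‖blockKernel E j (x - v)‖ * g (v - y)‖ₑ = ‖blockKernel E j (x - v)‖ₑ * ‖g (v - y)‖ₑ := by
      intro y
      rw [enorm_mul, enorm_norm]
    simp_rw [h1]
    rw [lintegral_const_mul' _ _ enorm_ne_top, lintegral_sub_left_eq_self (fun z => ‖g z‖ₑ) v]
  simp_rw [hinner]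
  rw [lintegral_mul_const' _ _ hg.2.ne]
  refine ENNReal.mul_lt_top ?_ hg.2
  have h := lintegral_enorm_blockKernel_lt_top (E := E) j
  calc ∫⁻ v, ‖blockKernel E j (x - v)‖ₑ = ∫⁻ v, ‖blockKernel E j v‖ₑ :=
        lintegral_sub_left_eq_self (fun v => ‖blockKernel E j v‖ₑ) x
    _ < ∞ := h

/-- **The block of a slice is the convolution with the blocked kernel**: for bounded measurable
fields `a`, `b` and `σ > 0`,
`Δ̇_j (w ↦ ∫ K(σ, w-y)[a(y), b(y)] dy)(x) = ∫ Δ̇_j K(σ,·)[a(y), b(y)](x - y) dy`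
(Fubini on `E × E`: the integrand `K_j(x-v) K(σ, v-y)[a(y), b(y)]` is dominated by
`‖a‖_∞‖b‖_∞ |K_j(x-v)| C(σ+‖v-y‖²)^{-(d+1)/2}`, integrable by Tonelli). [folklore] -/
theorem blockFn_oseenSlice_apply (j : ℤ) {σ : ℝ} (hσ : 0 < σ) {a b : E → E}
    (ha : AEStronglyMeasurable a volume) (hb : AEStronglyMeasurable b volume) {Ma Mb : ℝ}
    (hMa : ∀ y, ‖a y‖ ≤ Ma) (hMb : ∀ y, ‖b y‖ ≤ Mb) (x : E) :
    blockFn j (fun w => ∫ y, oseenKernel σ (w - y) (a y) (b y)) x =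
      ∫ y, blockFn j (fun w => oseenKernel σ w (a y) (b y)) (x - y) := by
  set d : ℝ := (Module.finrank ℝ E : ℝ) with hd
  obtain ⟨CK, hCK, hK⟩ := exists_norm_oseenKernel_le (E := E)
  have hMa0 : 0 ≤ Ma := (norm_nonneg _).trans (hMa x)
  have hMb0 : 0 ≤ Mb := (norm_nonneg _).trans (hMb x)
  -- the integrand on `E × E` (variables `(v, y)`)
  set F : E → E → E := fun v y => blockKernel E j (x - v) • oseenKernel σ (v - y) (a y) (b y) with hF
  -- ### measurability
  have hFm : AEStronglyMeasurable (uncurry F) ((volume : Measure E).prod volume) := by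
    have h1 : AEStronglyMeasurable (fun q : E × E => blockKernel E j (x - q.1))
        ((volume : Measure E).prod volume) :=
      ((FunctionSpaces.continuous_blockKernel j).comp (continuous_const.sub continuous_fst)).aestronglyMeasurable
    have h2 : AEMeasurable (fun q : E × E => oseenKernel σ (q.1 - q.2) (a q.2) (b q.2))
        ((volume : Measure E).prod volume) :=
      AEMeasurable.oseenKernel_comp aemeasurable_const (measurable_fst.sub measurable_snd).aemeasurable
        ha.aemeasurable.comp_snd hb.aemeasurable.comp_snd
    exact h1.smul h2.aestronglyMeasurable
  -- ### domination by an integrable product kernel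
  set g : E → ℝ := fun z => CK * Ma * Mb * (σ + ‖z‖ ^ 2) ^ (-((d + 1) / 2)) with hg
  have hg0 : ∀ z, 0 ≤ g z := fun z => by simp only [hg]; positivity
  have hgc : Continuous g := by
    have hc : Continuous fun z : E => σ + ‖z‖ ^ 2 := by fun_prop
    exact continuous_const.mul (hc.rpow_const fun z => Or.inl (by positivity : σ + ‖z‖ ^ 2 ≠ 0))
  have he : d < 2 * ((d + 1) / 2) := by linarith
  have hgi : Integrable g := (integrable_add_norm_sq_rpow_neg (E := E) he hσ).const_mul _
  have hdom : ∀ q : E × E, ‖uncurry F q‖ ≤ ‖blockKernel E j (x - q.1)‖ * g (q.1 - q.2) := by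
    rintro ⟨v, y⟩
    simp only [uncurry_apply_pair, hF, hg, norm_smul]
    refine mul_le_mul_of_nonneg_left ?_ (norm_nonneg _)
    calc ‖oseenKernel σ (v - y) (a y) (b y)‖
        ≤ CK * (σ + ‖v - y‖ ^ 2) ^ (-((d + 1) / 2)) * ‖a y‖ * ‖b y‖ := hK hσ (v - y) (a y) (b y)
      _ ≤ CK * (σ + ‖v - y‖ ^ 2) ^ (-((d + 1) / 2)) * Ma * Mb := by
          have hw0 : 0 ≤ CK * (σ + ‖v - y‖ ^ 2) ^ (-((d + 1) / 2)) :=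
            mul_nonneg hCK.le (Real.rpow_nonneg (by positivity) _)
          have h1 : CK * (σ + ‖v - y‖ ^ 2) ^ (-((d + 1) / 2)) * ‖a y‖ ≤
              CK * (σ + ‖v - y‖ ^ 2) ^ (-((d + 1) / 2)) * Ma := mul_le_mul_of_nonneg_left (hMa y) hw0
          calc CK * (σ + ‖v - y‖ ^ 2) ^ (-((d + 1) / 2)) * ‖a y‖ * ‖b y‖
              ≤ CK * (σ + ‖v - y‖ ^ 2) ^ (-((d + 1) / 2)) * Ma * ‖b y‖ :=
                mul_le_mul_of_nonneg_right h1 (norm_nonneg _)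
            _ ≤ CK * (σ + ‖v - y‖ ^ 2) ^ (-((d + 1) / 2)) * Ma * Mb :=
                mul_le_mul_of_nonneg_left (hMb y) (mul_nonneg hw0 hMa0)
      _ = CK * Ma * Mb * (σ + ‖v - y‖ ^ 2) ^ (-((d + 1) / 2)) := by ring
  have hFint : Integrable (uncurry F) ((volume : Measure E).prod volume) :=
    (integrable_blockKernel_mul_comp_sub j x hgi hgc hg0).mono' hFm (Eventually.of_forall hdom)
  -- ### Fubini
  calc blockFn j (fun w => ∫ y, oseenKernel σ (w - y) (a y) (b y)) x
      = ∫ v, ∫ y, F v y := by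
        rw [blockFn_apply_sub]
        refine integral_congr_ae (Eventually.of_forall fun v => ?_)
        simp only [hF]
        rw [integral_smul]
    _ = ∫ y, ∫ v, F v y := integral_integral_swap hFint
    _ = ∫ y, blockFn j (fun w => oseenKernel σ w (a y) (b y)) (x - y) := by
        refine integral_congr_ae (Eventually.of_forall fun y => ?_)
        simp only [hF]
        rw [blockFn_apply_sub]
        have h := integral_sub_right_eq_self (μ := (volume : Measure E))
          (fun w => blockKernel E j (x - y - w) • oseenKernel σ w (a y) (b y)) y
        rw [← h]
        refine integral_congr_ae (Eventually.of_forall fun v => ?_)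
        simp only [sub_sub_sub_cancel_right]

/-- **Pointwise domination of the block of a slice by the scalar majorant**: with
`m(z) = ∑_{k,l} ‖Δ̇_j K(σ,·)[e_k,e_l](z)‖`,
`‖Δ̇_j e^{σΔ}ℙ∇·(a⊗b)(x)‖ ≤ ∫ m(y) ‖a(x-y)‖‖b(x-y)‖ dy` (in `ℝ≥0∞`). [folklore] -/
theorem enorm_blockFn_oseenSlice_le (j : ℤ) {σ : ℝ} (hσ : 0 < σ) {a b : E → E}
    (ha : AEStronglyMeasurable a volume) (hb : AEStronglyMeasurable b volume) {Ma Mb : ℝ}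
    (hMa : ∀ y, ‖a y‖ ≤ Ma) (hMb : ∀ y, ‖b y‖ ≤ Mb) (x : E) :
    ‖blockFn j (fun w => ∫ y, oseenKernel σ (w - y) (a y) (b y)) x‖ₑ ≤
      ∫⁻ y, ‖∑ k, ∑ l, ‖blockFn j (fun w => oseenKernel σ w (stdOrthonormalBasis ℝ E k)
          (stdOrthonormalBasis ℝ E l)) y‖‖ₑ * ‖(‖a (x - y)‖ * ‖b (x - y)‖)‖ₑ := by
  rw [blockFn_oseenSlice_apply j hσ ha hb hMa hMb x]
  refine (enorm_integral_le_lintegral_enorm _).trans ?_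
  -- reflect `y ↦ x - y`
  have hrefl : ∫⁻ y, ‖blockFn j (fun w => oseenKernel σ w (a y) (b y)) (x - y)‖ₑ =
      ∫⁻ y, ‖blockFn j (fun w => oseenKernel σ w (a (x - y)) (b (x - y))) y‖ₑ := by
    have h := lintegral_sub_left_eq_self (μ := (volume : Measure E))
      (fun y => ‖blockFn j (fun w => oseenKernel σ w (a (x - y)) (b (x - y))) y‖ₑ) x
    simp only [sub_sub_cancel] at h
    exact h
  rw [hrefl]
  refine lintegral_mono fun y => ?_
  rw [← ofReal_norm, ← ofReal_norm, ← ofReal_norm, ← ENNReal.ofReal_mul (norm_nonneg _),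
    Real.norm_of_nonneg (Finset.sum_nonneg fun k _ => Finset.sum_nonneg fun l _ => norm_nonneg _),
    Real.norm_of_nonneg (mul_nonneg (norm_nonneg _) (norm_nonneg _)), ← mul_assoc]
  exact ENNReal.ofReal_le_ofReal (norm_blockFn_oseenKernel_le_sum_mul j hσ _ _ y)

/-- **Young's inequality for the blocks of a slice**: for bounded measurable `a`, `b`, `σ > 0`
and `1 ≤ p ≤ ∞`,
`‖Δ̇_j e^{σΔ}ℙ∇·(a⊗b)‖_{L^p} ≤ (∫ m) · ‖ |a| |b| ‖_{L^p}`, `m = ∑_{k,l} ‖Δ̇_j K(σ,·)[e_k,e_l]‖` the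
scalar majorant of the blocked kernel. [folklore] -/
theorem eLpNorm_blockFn_oseenSlice_le (j : ℤ) {σ : ℝ} (hσ : 0 < σ) {a b : E → E}
    (ha : AEStronglyMeasurable a volume) (hb : AEStronglyMeasurable b volume) {Ma Mb : ℝ}
    (hMa : ∀ y, ‖a y‖ ≤ Ma) (hMb : ∀ y, ‖b y‖ ≤ Mb) {p : ℝ≥0∞} (hp : 1 ≤ p) :
    eLpNorm (blockFn j (fun w => ∫ y, oseenKernel σ (w - y) (a y) (b y))) p volume ≤
      (∫⁻ y, ‖∑ k, ∑ l, ‖blockFn j (fun w => oseenKernel σ w (stdOrthonormalBasis ℝ E k)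
          (stdOrthonormalBasis ℝ E l)) y‖‖ₑ) * eLpNorm (fun y => ‖a y‖ * ‖b y‖) p volume := by
  have hm : AEStronglyMeasurable (fun y => ∑ k, ∑ l, ‖blockFn j (fun w => oseenKernel σ w
      (stdOrthonormalBasis ℝ E k) (stdOrthonormalBasis ℝ E l)) y‖) volume := by
    refine Finset.aestronglyMeasurable_fun_sum (μ := (volume : Measure E))
      (Finset.univ : Finset (Fin (Module.finrank ℝ E))) fun k _ => ?_
    refine Finset.aestronglyMeasurable_fun_sum (μ := (volume : Measure E))
      (Finset.univ : Finset (Fin (Module.finrank ℝ E))) fun l _ => ?_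
    exact (aestronglyMeasurable_blockFn_oseenKernel j σ _ _).norm
  have hf : AEStronglyMeasurable (fun y => ‖a y‖ * ‖b y‖) volume := ha.norm.mul hb.norm
  exact eLpNorm_le_lintegral_mul_eLpNorm_of_dominated hm hf
    (fun x => enorm_blockFn_oseenSlice_le j hσ ha hb hMa hMb x) hp

end Slice

end Literature.Analysis.FluidPDE


namespace Literature.Analysis.FluidPDE

open FunctionSpaces (blockFn blockKernel)

/-! ## The blocks of the Duhamel term `B(u, v)(t) = ∫₀ᵗ e^{(t-s)Δ}ℙ∇·(u ⊗ v)(s) ds` -/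

section Duhamel

variable {E : Type*} [NormedAddCommGroup E] [InnerProductSpace ℝ E] [FiniteDimensional ℝ E]
  [MeasurableSpace E] [BorelSpace E]

/-- Joint measurability of the slices `(s, x) ↦ ∫ K(t-s, x-y)[u(s,y), v(s,y)] dy` of the Duhamel
term at unit viscosity (`stronglyMeasurable_oseenIntegrand` with `ν = 1`). [folklore] -/
theorem stronglyMeasurable_oseenIntegrand_unit {u v : ℝ → E → E} (hum : Measurable (uncurry u))
    (hvm : Measurable (uncurry v)) (t : ℝ) :
    StronglyMeasurable (uncurry fun (s : ℝ) (x : E) =>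
      ∫ y, oseenKernel (t - s) (x - y) (u s y) (v s y)) := by
  have h := stronglyMeasurable_oseenIntegrand hum hvm 1 t
  simp only [one_mul] at h
  exact h

/-- Hölder for the block integrand: `∫ ‖K_j(z)‖ ‖f(x - z)‖ dz ≤ ‖K_j‖_{L^{p'}} ‖f‖_{L^p}` in `ℝ≥0∞`.
[folklore] -/
theorem lintegral_enorm_blockKernel_mul_enorm_comp_sub_le (j : ℤ) {f : E → E}
    (hf : AEStronglyMeasurable f volume) (p p' : ℝ≥0∞) [hpp : p'.HolderConjugate p] (x : E) :
    ∫⁻ z, ‖blockKernel E j z‖ₑ * ‖f (x - z)‖ₑ ≤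
      eLpNorm (blockKernel E j) p' volume * eLpNorm f p volume := by
  have hmp : MeasurePreserving (fun z : E => x - z) volume volume :=
    Measure.measurePreserving_sub_left volume x
  have hg : AEStronglyMeasurable (fun z => f (x - z)) volume := hf.comp_measurePreserving hmp
  have hK : AEStronglyMeasurable (blockKernel E j) volume :=
    (FunctionSpaces.continuous_blockKernel j).aestronglyMeasurable
  calc ∫⁻ z, ‖blockKernel E j z‖ₑ * ‖f (x - z)‖ₑ
      = eLpNorm (blockKernel E j • fun z => f (x - z)) 1 volume := by
        rw [eLpNorm_one_eq_lintegral_enorm]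
        simp_rw [Pi.smul_apply', enorm_smul]
    _ ≤ eLpNorm (blockKernel E j) p' volume * eLpNorm (fun z => f (x - z)) p volume :=
        eLpNorm_smul_le_mul_eLpNorm hg hK
    _ = eLpNorm (blockKernel E j) p' volume * eLpNorm f p volume := by
        rw [show (fun z => f (x - z)) = f ∘ (fun z => x - z) from rfl,
          eLpNorm_comp_measurePreserving hf hmp]

/-- **The block of a time integral of slices is the time integral of the blocks** (Fubini on
`E × (0,t)`): if `S : ℝ → E → E` is jointly measurable with `S(s) ∈ L^p` and
`‖S(s)‖_{L^p} ≤ Φ(s)` for an integrable `Φ` on `(0,t)`, then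
`Δ̇_j (x ↦ ∫_{(0,t)} S(s, x) ds)(x) = ∫_{(0,t)} Δ̇_j S(s)(x) ds` (the integrand `K_j(z) S(s, x-z)` is
integrable by Hölder, `∫‖K_j(z)‖‖S(s,x-z)‖dz ≤ ‖K_j‖_{L^{p'}}Φ(s)`). [folklore] -/
theorem blockFn_setIntegral_apply (j : ℤ) {S : ℝ → E → E} (hSm : StronglyMeasurable (uncurry S))
    {t₀ t : ℝ} {p : ℝ≥0∞} (hp : 1 ≤ p) {Φ : ℝ → ℝ}
    (hSΦ : ∀ s ∈ Ioo t₀ t, eLpNorm (S s) p volume ≤ ENNReal.ofReal (Φ s))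
    (hΦ0 : ∀ s ∈ Ioo t₀ t, 0 ≤ Φ s) (hΦi : IntegrableOn Φ (Ioo t₀ t)) (x : E) :
    blockFn j (fun w => ∫ s in Ioo t₀ t, S s w) x = ∫ s in Ioo t₀ t, blockFn j (S s) x := by
  haveI hp1 : Fact (1 ≤ p) := ⟨hp⟩
  haveI hHC : p.HolderConjugate (ENNReal.conjExponent p) := .conjExponent hp
  haveI hHC' : (ENNReal.conjExponent p).HolderConjugate p := inferInstance
  have hKq : eLpNorm (blockKernel E j) (ENNReal.conjExponent p) volume < ∞ :=
    (FunctionSpaces.memLp_blockKernel j _).eLpNorm_lt_top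
  have hSs : ∀ s, AEStronglyMeasurable (S s) volume := fun s =>
    (hSm.comp_measurable (measurable_const.prodMk measurable_id)).aestronglyMeasurable
  have hSmem : ∀ s ∈ Ioo t₀ t, MemLp (S s) p volume := fun s hs =>
    ⟨hSs s, (hSΦ s hs).trans_lt ENNReal.ofReal_lt_top⟩
  -- the integrand `H(z, s) = K_j(z) S(s, x - z)` on `E × (0,t)`
  obtain ⟨H, hH⟩ : ∃ H : E → ℝ → E, H = fun z s => blockKernel E j z • S s (x - z) := ⟨_, rfl⟩
  have hHm : AEStronglyMeasurable (uncurry H)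
      ((volume : Measure E).prod ((volume : Measure ℝ).restrict (Ioo t₀ t))) := by
    have h1 : Measurable fun q : E × ℝ => S q.2 (x - q.1) :=
      hSm.measurable.comp (measurable_snd.prodMk (measurable_const.sub measurable_fst))
    have h2 : Measurable fun q : E × ℝ => blockKernel E j q.1 :=
      (FunctionSpaces.continuous_blockKernel j).measurable.comp measurable_fst
    have h3 : Measurable (uncurry H) := by
      rw [hH]
      exact h2.smul h1
    exact h3.aestronglyMeasurable
  have hHint : Integrable (uncurry H)
      ((volume : Measure E).prod ((volume : Measure ℝ).restrict (Ioo t₀ t))) := by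
    rw [integrable_prod_iff' hHm]
    refine ⟨?_, ?_⟩
    · refine (ae_restrict_iff' measurableSet_Ioo).2 (Eventually.of_forall fun s hs => ?_)
      have h := FunctionSpaces.integrable_blockKernel_smul_sub j (hSmem s hs) x
      rw [hH]
      exact h
    · have hgm : AEStronglyMeasurable (fun s => ∫ z, ‖uncurry H (z, s)‖)
          ((volume : Measure ℝ).restrict (Ioo t₀ t)) :=
        (hHm.norm.prod_swap).integral_prod_right'
      set L : ℝ := (eLpNorm (blockKernel E j) (ENNReal.conjExponent p) volume).toReal with hL
      refine Integrable.mono' (hΦi.const_mul L) hgm ?_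
      refine (ae_restrict_iff' measurableSet_Ioo).2 (Eventually.of_forall fun s hs => ?_)
      rw [Real.norm_of_nonneg (integral_nonneg fun z => norm_nonneg _)]
      have hlin := lintegral_enorm_blockKernel_mul_enorm_comp_sub_le j (hSs s) p
        (ENNReal.conjExponent p) x
      have hfin2 : eLpNorm (blockKernel E j) (ENNReal.conjExponent p) volume *
          eLpNorm (S s) p volume ≠ ∞ :=
        ENNReal.mul_ne_top hKq.ne (hSmem s hs).eLpNorm_ne_top
      have hint_s : Integrable (fun z => H z s) volume := by
        have h := FunctionSpaces.integrable_blockKernel_smul_sub j (hSmem s hs) x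
        rw [hH]
        exact h
      have h1 : ∫ z, ‖uncurry H (z, s)‖ = (∫⁻ z, ‖blockKernel E j z‖ₑ * ‖S s (x - z)‖ₑ).toReal := by
        show ∫ z, ‖H z s‖ = _
        rw [integral_eq_lintegral_of_nonneg_ae (Eventually.of_forall fun z => norm_nonneg _)
          hint_s.aestronglyMeasurable.norm]
        congr 1
        refine lintegral_congr fun z => ?_
        simp only [hH, norm_smul, ENNReal.ofReal_mul (norm_nonneg _), ofReal_norm]
      rw [h1]
      calc (∫⁻ z, ‖blockKernel E j z‖ₑ * ‖S s (x - z)‖ₑ).toReal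
          ≤ (eLpNorm (blockKernel E j) (ENNReal.conjExponent p) volume * eLpNorm (S s) p volume).toReal :=
            ENNReal.toReal_mono hfin2 hlin
        _ ≤ (eLpNorm (blockKernel E j) (ENNReal.conjExponent p) volume * ENNReal.ofReal (Φ s)).toReal :=
            ENNReal.toReal_mono (ENNReal.mul_ne_top hKq.ne ENNReal.ofReal_ne_top)
              (mul_le_mul_right (hSΦ s hs) _)
        _ = L * Φ s := by
            rw [ENNReal.toReal_mul, ENNReal.toReal_ofReal (hΦ0 s hs), hL]
  calc blockFn j (fun w => ∫ s in Ioo t₀ t, S s w) x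
      = ∫ z, ∫ s in Ioo t₀ t, H z s := by
        rw [FunctionSpaces.blockFn_apply]
        refine integral_congr_ae (Eventually.of_forall fun z => ?_)
        rw [hH]
        exact (integral_smul _ _).symm
    _ = ∫ s in Ioo t₀ t, ∫ z, H z s := integral_integral_swap hHint
    _ = ∫ s in Ioo t₀ t, blockFn j (S s) x := by
        refine integral_congr_ae (Eventually.of_forall fun s => ?_)
        show ∫ z, H z s = blockFn j (S s) x
        rw [FunctionSpaces.blockFn_apply, hH]

/-- **Minkowski's integral inequality for the blocks of a time integral of slices**: under the
hypotheses of `blockFn_setIntegral_apply` with `p < ∞`,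
`‖Δ̇_j ∫_{(0,t)} S(s) ds‖_{L^p} ≤ ∫_{(0,t)} ‖Δ̇_j S(s)‖_{L^p} ds`. [folklore] -/
theorem eLpNorm_blockFn_setIntegral_le (j : ℤ) {S : ℝ → E → E} (hSm : StronglyMeasurable (uncurry S))
    {t₀ t : ℝ} {p : ℝ≥0∞} (hp : 1 ≤ p) (hpt : p ≠ ∞) {Φ : ℝ → ℝ}
    (hSΦ : ∀ s ∈ Ioo t₀ t, eLpNorm (S s) p volume ≤ ENNReal.ofReal (Φ s))
    (hΦ0 : ∀ s ∈ Ioo t₀ t, 0 ≤ Φ s) (hΦi : IntegrableOn Φ (Ioo t₀ t)) :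
    eLpNorm (blockFn j (fun w => ∫ s in Ioo t₀ t, S s w)) p volume ≤
      ∫⁻ s in Ioo t₀ t, eLpNorm (blockFn j (S s)) p volume := by
  have heq : blockFn j (fun w => ∫ s in Ioo t₀ t, S s w) = fun x => ∫ s in Ioo t₀ t, blockFn j (S s) x :=
    funext (blockFn_setIntegral_apply j hSm hp hSΦ hΦ0 hΦi)
  rw [heq]
  have hGm : AEStronglyMeasurable (uncurry fun (x : E) (s : ℝ) => blockFn j (S s) x)
      ((volume : Measure E).prod ((volume : Measure ℝ).restrict (Ioo t₀ t))) := by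
    have h1 : Measurable fun q : (E × ℝ) × E => blockKernel E j q.2 • S q.1.2 (q.1.1 - q.2) :=
      ((FunctionSpaces.continuous_blockKernel j).measurable.comp measurable_snd).smul
        (hSm.measurable.comp (measurable_fst.snd.prodMk (measurable_fst.fst.sub measurable_snd)))
    have h2 : StronglyMeasurable fun q : E × ℝ =>
        ∫ z, blockKernel E j z • S q.2 (q.1 - z) ∂(volume : Measure E) :=
      h1.stronglyMeasurable.integral_prod_right'
    have heq' : (uncurry fun (x : E) (s : ℝ) => blockFn j (S s) x) =
        fun q : E × ℝ => ∫ z, blockKernel E j z • S q.2 (q.1 - z) := by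
      funext q
      exact FunctionSpaces.blockFn_apply j (S q.2) q.1
    rw [heq']
    exact h2.aestronglyMeasurable
  exact FunctionSpaces.eLpNorm_integral_le_lintegral_eLpNorm (μ := (volume : Measure E))
    (ν := (volume : Measure ℝ).restrict (Ioo t₀ t)) hGm hp hpt

/-- **The blocks of the Duhamel term, by Minkowski's inequality in time**: for jointly measurable
fields `u`, `v` bounded on each slice of `(0, t)`, `1 ≤ p < ∞`, and a nonnegative measurable weight
`N` with `‖ |u(s)| |v(s)| ‖_{L^p} ≤ N(s)` on `(0,t)` and `(t-s)^{-1/2} N(s)` integrable,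
`‖Δ̇_j B(u,v)(t)‖_{L^p} ≤ ∫₀ᵗ (∫ m_j(t-s)) N(s) ds`, `m_j(σ) = ∑_{k,l}‖Δ̇_j K(σ,·)[e_k,e_l]‖` the
scalar majorant of the blocked kernel (`Δ̇_j B(u,v)(t)(x) = ∫₀ᵗ Δ̇_j[e^{(t-s)Δ}ℙ∇·(u⊗v)(s)](x) ds` by
Fubini on `E × (0,t)`, the diagonal bound `‖T_σ[a,b]‖_{L^p} ≤ Cσ^{-1/2}‖|a||b|‖_{L^p}` giving the
integrability; then Minkowski's integral inequality and Young's inequality on each slice,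
`eLpNorm_blockFn_oseenSlice_le`). This is the block form of Kato's estimate (Kato 1984, (2.3);
BCD, proof of Thm. 5.40; GKP 2016, App. B). [cite: BahouriCheminDanchin2011, Thm. 5.40 (proof)] -/
theorem eLpNorm_blockFn_kochTataruBilinear_le (j : ℤ) {u v : ℝ → E → E}
    (hum : Measurable (uncurry u)) (hvm : Measurable (uncurry v)) {t : ℝ}
    {Mu Mv N : ℝ → ℝ} (hMu : ∀ s ∈ Ioo 0 t, ∀ y, ‖u s y‖ ≤ Mu s)
    (hMv : ∀ s ∈ Ioo 0 t, ∀ y, ‖v s y‖ ≤ Mv s) {p : ℝ≥0∞} (hp : 1 ≤ p) (hpt : p ≠ ∞)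
    (hN : ∀ s ∈ Ioo 0 t, eLpNorm (fun y => ‖u s y‖ * ‖v s y‖) p volume ≤ ENNReal.ofReal (N s))
    (hN0 : ∀ s ∈ Ioo 0 t, 0 ≤ N s)
    (hNi : IntegrableOn (fun s => (t - s) ^ (-(1 / 2 : ℝ)) * N s) (Ioo 0 t)) :
    eLpNorm (blockFn j (kochTataruBilinear u v t)) p volume ≤
      ∫⁻ s in Ioo 0 t, (∫⁻ y, ‖∑ k, ∑ l, ‖blockFn j (fun w => oseenKernel (t - s) w
          (stdOrthonormalBasis ℝ E k) (stdOrthonormalBasis ℝ E l)) y‖‖ₑ) * ENNReal.ofReal (N s) := by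
  set d : ℝ := (Module.finrank ℝ E : ℝ) with hd
  obtain ⟨CK, hCK, hK⟩ := exists_norm_oseenKernel_le (E := E)
  set M₁ : ℝ := ∫ w : E, (1 + ‖w‖ ^ 2) ^ (-((d + 1) / 2)) with hM₁
  have he₁ : d < 2 * ((d + 1) / 2) := by linarith
  have hM₁0 : 0 < M₁ := integral_one_add_norm_sq_rpow_neg_pos he₁
  -- ### the slices
  obtain ⟨S, hS⟩ : ∃ S : ℝ → E → E, S = fun s x => ∫ y, oseenKernel (t - s) (x - y) (u s y) (v s y) :=
    ⟨_, rfl⟩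
  have hSm : StronglyMeasurable (uncurry S) := by
    rw [hS]; exact stronglyMeasurable_oseenIntegrand_unit hum hvm t
  have hSp : ∀ s ∈ Ioo 0 t, eLpNorm (S s) p volume ≤
      ENNReal.ofReal (CK * M₁ * ((t - s) ^ (-(1 / 2 : ℝ)) * N s)) := by
    intro s hs
    have hσ : 0 < t - s := sub_pos.2 hs.2
    have h := eLpNorm_oseenSlice_le_same hCK.le hK hσ (measurable_slice hum s).aestronglyMeasurable
      (measurable_slice hvm s).aestronglyMeasurable hp
    rw [hS]
    refine h.trans ((mul_le_mul_right (hN s hs) _).trans (le_of_eq ?_))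
    rw [← ENNReal.ofReal_mul (by positivity)]
    congr 1; ring
  have hBeq : kochTataruBilinear u v t = fun w => ∫ s in Ioo 0 t, S s w := by
    funext w
    rw [hS]
    rfl
  rw [hBeq]
  refine (eLpNorm_blockFn_setIntegral_le j hSm hp hpt hSp
    (fun s hs => mul_nonneg (by positivity)
      (mul_nonneg (Real.rpow_nonneg (sub_pos.2 hs.2).le _) (hN0 s hs)))
    (hNi.const_mul (CK * M₁))).trans ?_
  refine setLIntegral_mono' measurableSet_Ioo fun s hs => ?_
  have hσ : 0 < t - s := sub_pos.2 hs.2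
  have hslice : S s = fun x => ∫ y, oseenKernel (t - s) (x - y) (u s y) (v s y) := by rw [hS]
  rw [hslice]
  calc eLpNorm (blockFn j (fun x => ∫ y, oseenKernel (t - s) (x - y) (u s y) (v s y))) p volume
      ≤ (∫⁻ y, ‖∑ k, ∑ l, ‖blockFn j (fun w => oseenKernel (t - s) w
          (stdOrthonormalBasis ℝ E k) (stdOrthonormalBasis ℝ E l)) y‖‖ₑ) *
          eLpNorm (fun y => ‖u s y‖ * ‖v s y‖) p volume :=
        eLpNorm_blockFn_oseenSlice_le j hσ (measurable_slice hum s).aestronglyMeasurable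
          (measurable_slice hvm s).aestronglyMeasurable (hMu s hs) (hMv s hs) hp
    _ ≤ _ := mul_le_mul_right (hN s hs) _

/-- **The blocks of the Duhamel term from a positive initial time** `B¹_{t₀}(u,v)(t) =
∫_{t₀}^t e^{(t-s)Δ}ℙ∇·(u⊗v)(s) ds` (`oseenDuhamel 1 t₀`, the short-time pieces of the restart
identity): under the same hypotheses on `(t₀, t)`,
`‖Δ̇_j B¹_{t₀}(u,v)(t)‖_{L^p} ≤ ∫_{t₀}^t ‖m_j(t-s)‖_{L¹} N(s) ds`. [cite: BahouriCheminDanchin2011, Thm. 5.40 (proof)] -/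
theorem eLpNorm_blockFn_oseenDuhamel_one_le (j : ℤ) {u v : ℝ → E → E}
    (hum : Measurable (uncurry u)) (hvm : Measurable (uncurry v)) {t₀ t : ℝ}
    {Mu Mv N : ℝ → ℝ} (hMu : ∀ s ∈ Ioo t₀ t, ∀ y, ‖u s y‖ ≤ Mu s)
    (hMv : ∀ s ∈ Ioo t₀ t, ∀ y, ‖v s y‖ ≤ Mv s) {p : ℝ≥0∞} (hp : 1 ≤ p) (hpt : p ≠ ∞)
    (hN : ∀ s ∈ Ioo t₀ t, eLpNorm (fun y => ‖u s y‖ * ‖v s y‖) p volume ≤ ENNReal.ofReal (N s))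
    (hN0 : ∀ s ∈ Ioo t₀ t, 0 ≤ N s)
    (hNi : IntegrableOn (fun s => (t - s) ^ (-(1 / 2 : ℝ)) * N s) (Ioo t₀ t)) :
    eLpNorm (blockFn j (oseenDuhamel 1 t₀ u v t)) p volume ≤
      ∫⁻ s in Ioo t₀ t, (∫⁻ y, ‖∑ k, ∑ l, ‖blockFn j (fun w => oseenKernel (t - s) w
          (stdOrthonormalBasis ℝ E k) (stdOrthonormalBasis ℝ E l)) y‖‖ₑ) * ENNReal.ofReal (N s) := by
  set d : ℝ := (Module.finrank ℝ E : ℝ) with hd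
  obtain ⟨CK, hCK, hK⟩ := exists_norm_oseenKernel_le (E := E)
  set M₁ : ℝ := ∫ w : E, (1 + ‖w‖ ^ 2) ^ (-((d + 1) / 2)) with hM₁
  have he₁ : d < 2 * ((d + 1) / 2) := by linarith
  have hM₁0 : 0 < M₁ := integral_one_add_norm_sq_rpow_neg_pos he₁
  -- ### the slices
  obtain ⟨S, hS⟩ : ∃ S : ℝ → E → E, S = fun s x => ∫ y, oseenKernel (t - s) (x - y) (u s y) (v s y) :=
    ⟨_, rfl⟩
  have hSm : StronglyMeasurable (uncurry S) := by
    rw [hS]; exact stronglyMeasurable_oseenIntegrand_unit hum hvm t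
  have hSp : ∀ s ∈ Ioo t₀ t, eLpNorm (S s) p volume ≤
      ENNReal.ofReal (CK * M₁ * ((t - s) ^ (-(1 / 2 : ℝ)) * N s)) := by
    intro s hs
    have hσ : 0 < t - s := sub_pos.2 hs.2
    have h := eLpNorm_oseenSlice_le_same hCK.le hK hσ (measurable_slice hum s).aestronglyMeasurable
      (measurable_slice hvm s).aestronglyMeasurable hp
    rw [hS]
    refine h.trans ((mul_le_mul_right (hN s hs) _).trans (le_of_eq ?_))
    rw [← ENNReal.ofReal_mul (by positivity)]
    congr 1; ring
  have hBeq : oseenDuhamel 1 t₀ u v t = fun w => ∫ s in Ioo t₀ t, S s w := by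
    funext w
    rw [hS, oseenDuhamel]
    simp only [one_mul]
  rw [hBeq]
  refine (eLpNorm_blockFn_setIntegral_le j hSm hp hpt hSp
    (fun s hs => mul_nonneg (by positivity)
      (mul_nonneg (Real.rpow_nonneg (sub_pos.2 hs.2).le _) (hN0 s hs)))
    (hNi.const_mul (CK * M₁))).trans ?_
  refine setLIntegral_mono' measurableSet_Ioo fun s hs => ?_
  have hσ : 0 < t - s := sub_pos.2 hs.2
  have hslice : S s = fun x => ∫ y, oseenKernel (t - s) (x - y) (u s y) (v s y) := by rw [hS]
  rw [hslice]
  calc eLpNorm (blockFn j (fun x => ∫ y, oseenKernel (t - s) (x - y) (u s y) (v s y))) p volume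
      ≤ (∫⁻ y, ‖∑ k, ∑ l, ‖blockFn j (fun w => oseenKernel (t - s) w
          (stdOrthonormalBasis ℝ E k) (stdOrthonormalBasis ℝ E l)) y‖‖ₑ) *
          eLpNorm (fun y => ‖u s y‖ * ‖v s y‖) p volume :=
        eLpNorm_blockFn_oseenSlice_le j hσ (measurable_slice hum s).aestronglyMeasurable
          (measurable_slice hvm s).aestronglyMeasurable (hMu s hs) (hMv s hs) hp
    _ ≤ _ := mul_le_mul_right (hN s hs) _

end Duhamel

end Literature.Analysis.FluidPDE
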